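import Summits.QuantumAdvantage.QuantumAdvantage.Theorems.RankDialH2
import HarnessLib

/-!
# RankDial (H3) — §21 the pieces: `WindowMixedLinSel p` PROVED for `p ≠ 3`, the junta corollary, the CROWD residual `WindowCrowdLinSel p s`, `highRank_iff_crowd`, `r5_residual_crowd`, `mixed_dial`

TARGET BY NAME (cell decomp-qadv, RESIDUAL MODE): item stmt-QuantumAdvantage-23109
`Summit.QuantumAdvantage.QuantumAdvantage.Theses.OddPrimeWalk.ManyReadersSqrtOdd`, through rung R5 = `AdviceFreeQNC0.WalkHardFLinSel p`.
This file SUPPORTS the item (`--supports`); it does not close it.  Declaration bodies are byte-identical to the cell node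
«MixedDial» (decomp-qadv lens-1, generation 26, part H; node file RankDialH.lean, whose §1–§17 are node «DegreeDial» =
parts G1–G2), cut into ≤ 400-line parts
H1 (§18 Viola–Wigderson with per-coordinate phases, §19 characters / phases / wide-test expansion) → H2 (§20 mixed fibre and window theorems) → H3 (§21 pieces `WindowMixedLinSel` PROVED `p ≠ 3`, residual `WindowCrowdLinSel`, `mixed_dial`);
see the node file for the mechanism summary.
-/

set_option linter.dupNamespace false
set_option autoImplicit false

noncomputable section
open Classical

namespace Summit.QuantumAdvantage.QuantumAdvantage.Theorems.RankDial

open Finset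
open Summit.QuantumAdvantage.AdviceFreeQNC0
open Literature.Computability.MetaComplexity Literature.Computability.MetaComplexity.Smolensky
/-! ### §21 The pieces: the MIXED LAW (proved for `p ≠ 3`), its corollaries, and the CROWD residual -/

section MixedPieces
variable (p : ℕ) [Fact p.Prime]

/-- **PIECE `WindowMixedLinSel p`** (the mixed grade, linear tests): for every width `s` there are `θ < 1` and a
budget unit `M` such that a linear-test strategy with a cut-free window of length `ℓ`, ANY number of cuts of window
support `≤ s` and `k` cuts of window support `> s` with `(k + 2)·M ≤ ℓ`, wins on `≤ θ·2ⁿ` inputs.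
[NECESSARY · contains the junta piece (`k = 0`) and g24's few-readers piece (`s = 0`) · **PROVED for every prime
`p ≠ 3`**: `windowMixedLinSel_holds` (`θ = 11/12`, `M = ⌈2·4^{s+1}/η_p⌉`, `η_p = 2sin²(π/3p)`).] -/
def WindowMixedLinSel : Prop :=
  ∀ s : ℕ, ∃ θ : ℝ, θ < 1 ∧ ∃ M : ℕ, ∀ L ℓ R : ℕ,
    ∀ (c : ℕ) (y : Fin (L + ℓ + R + 1) → (Fin (L + ℓ + R) → Bool) → Bool)
      (lam : Fin (L + ℓ + R + 1) → Fin (L + ℓ + R) → ZMod p) (rr : Fin (L + ℓ + R + 1) → ZMod p),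
      (∀ g u, y g u = decide ((∑ i, if u i then lam g i else 0) = rr g)) → CutFree y L ℓ →
      ((univ.filter fun g : Fin (L + ℓ + R + 1) => s < (wsupp lam g).card).card + 2) * M ≤ ℓ →
      ((univ.filter fun u : Fin (L + ℓ + R) → Bool => ringWinU c y u = true).card : ℝ) ≤ θ * (2 : ℝ) ^ (L + ℓ + R)

/-- **THE MIXED LAW IS A THEOREM** for every prime `p ≠ 3` (`θ = 11/12`). -/
theorem windowMixedLinSel_holds (hp3 : p ≠ 3) : WindowMixedLinSel p := by
  intro s
  obtain ⟨M, hM⟩ : ∃ M : ℕ, 2 * 4 ^ (s + 1) ≤ (M : ℝ) * etaP p := by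
    obtain ⟨M, hM⟩ := exists_nat_ge (2 * 4 ^ (s + 1) / etaP p)
    exact ⟨M, by rwa [div_le_iff₀ (etaP_pos (p := p))] at hM⟩
  refine ⟨11 / 12, by norm_num, M, fun L ℓ R c y lam rr hyl hgap hℓ => ?_⟩
  have h := window_bound_mixed hp3 L ℓ R c y lam rr hyl hgap hM hℓ
  have h' : (12 : ℝ) * ((univ.filter fun u : Fin (L + ℓ + R) → Bool => ringWinU c y u = true).card : ℝ) ≤
      11 * (2 : ℝ) ^ (L + ℓ + R) := by exact_mod_cast h
  linarith

/-- NECESSARY: rung R5 implies the mixed piece (sanity). -/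
theorem windowMixed_of_r5 (h : WalkHardFLinSel p) : WindowMixedLinSel p := by
  intro s
  obtain ⟨θ, hθ, n₀, h⟩ := h
  refine ⟨θ, hθ, n₀, fun L ℓ R c y lam rr hyl _ hℓ => ?_⟩
  have hn : n₀ ≤ L + ℓ + R := by nlinarith [hℓ]
  exact h (L + ℓ + R) hn c y fun g => ⟨lam g, rr g, hyl g⟩

/-- **The mixed law contains the junta law** (`k = 0`, `ℓ₀ = 2M`). -/
theorem windowJunta_of_mixed (h : WindowMixedLinSel p) : WindowJuntaLinSel p := by
  intro s
  obtain ⟨θ, hθ, M, h⟩ := h s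
  refine ⟨θ, hθ, 2 * M, fun L ℓ R hℓ c y lam rr hyl hgap hs => h L ℓ R c y lam rr hyl hgap ?_⟩
  have h0 : (univ.filter fun g : Fin (L + ℓ + R + 1) => s < (wsupp lam g).card).card = 0 := by
    rw [Finset.card_eq_zero, Finset.filter_eq_empty_iff]
    exact fun g _ => not_lt.2 (hs g)
  rw [h0]
  omega

/-- **PIECE `WindowCrowdLinSel p s`** (the residual of the high-rank piece after the mixed law): the high-rank piece
restricted to CROWDED windows — more than `ℓ/E` cuts of window support `> s` (in the given linear representation),
sketch dimension `> ℓ/E`.  [NECESSARY (`crowd_of_highRank`) · with the mixed law EQUIVALENT to the high-rank piece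
(`highRank_iff_crowd`) · IDEA-NEEDED: why it might fail as a route — it contains the dense core "one wide counter per
cut" (every cut reads the whole window mod `p`), which no character/degree estimate of this file touches.] -/
def WindowCrowdLinSel (s : ℕ) : Prop :=
  ∀ E : ℕ, 0 < E → ∃ θ : ℝ, θ < 1 ∧ ∃ C : ℕ, ∃ n₀ : ℕ, ∀ L ℓ R : ℕ, n₀ ≤ L + ℓ + R →
    C * (Nat.log 2 (L + ℓ + R) + 1) ≤ ℓ →
    ∀ (c : ℕ) (y : Fin (L + ℓ + R + 1) → (Fin (L + ℓ + R) → Bool) → Bool)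
      (lam : Fin (L + ℓ + R + 1) → Fin (L + ℓ + R) → ZMod p) (rr : Fin (L + ℓ + R + 1) → ZMod p),
      (∀ g u, y g u = decide ((∑ i, if u i then lam g i else 0) = rr g)) → CutFree y L ℓ →
      ¬ RankLE p y (ℓ / E) → ℓ / E < (univ.filter fun g : Fin (L + ℓ + R + 1) => s < (wsupp lam g).card).card →
      ((univ.filter fun u : Fin (L + ℓ + R) → Bool => ringWinU c y u = true).card : ℝ) ≤ θ * (2 : ℝ) ^ (L + ℓ + R)

/-- NECESSARY: the high-rank piece implies the crowd piece (drop hypotheses). -/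
theorem crowd_of_highRank (s : ℕ) (h : WindowHighRankLinSel p) : WindowCrowdLinSel p s := by
  intro E hE
  obtain ⟨θ, hθ, C, n₀, h⟩ := h E hE
  exact ⟨θ, hθ, C, n₀, fun L ℓ R hn hC c y lam rr hyl hgap hr _ =>
    h L ℓ R hn hC c y (fun g => ⟨lam g, rr g, hyl g⟩) hgap hr⟩

/-- **The mixed law shrinks the residual**: mixed law ∧ crowd piece ⟹ high-rank piece. -/
theorem highRank_of_mixed_crowd (s : ℕ) (hMix : WindowMixedLinSel p) (hCr : WindowCrowdLinSel p s) :
    WindowHighRankLinSel p := by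
  intro E hE
  obtain ⟨θ₁, hθ₁, M, hMix⟩ := hMix s
  obtain ⟨θ₂, hθ₂, C₂, n₂, hCr⟩ := hCr (max E (3 * (M + 1))) (lt_of_lt_of_le hE (le_max_left _ _))
  refine ⟨max θ₁ θ₂, max_lt hθ₁ hθ₂, max C₂ (3 * (M + 1)), n₂, fun L ℓ R hn hCle c y hy hgap hr => ?_⟩
  have hlog : 1 ≤ Nat.log 2 (L + ℓ + R) + 1 := Nat.le_add_left 1 _
  have hC₂ : C₂ * (Nat.log 2 (L + ℓ + R) + 1) ≤ ℓ :=
    le_trans (Nat.mul_le_mul_right _ (le_max_left C₂ _)) hCle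
  have h3M : 3 * (M + 1) ≤ ℓ :=
    le_trans (le_trans (le_max_right C₂ _) (Nat.le_mul_of_pos_right _ hlog)) hCle
  have hpos : (0 : ℝ) ≤ (2 : ℝ) ^ (L + ℓ + R) := by positivity
  choose lam rr hyl using hy
  by_cases hk : ℓ / max E (3 * (M + 1)) < (univ.filter fun g : Fin (L + ℓ + R + 1) => s < (wsupp lam g).card).card
  · have hr' : ¬ RankLE p y (ℓ / max E (3 * (M + 1))) :=
      fun h => hr (rankLE_mono h (Nat.div_le_div_left (le_max_left _ _) hE))
    exact le_trans (hCr L ℓ R hn hC₂ c y lam rr hyl hgap hr' hk) (mul_le_mul_of_nonneg_right (le_max_right θ₁ θ₂) hpos)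
  · have hk' : (univ.filter fun g : Fin (L + ℓ + R + 1) => s < (wsupp lam g).card).card ≤ ℓ / max E (3 * (M + 1)) :=
      not_lt.1 hk
    set q := ℓ / (3 * (M + 1)) with hq
    have hqE : ℓ / max E (3 * (M + 1)) ≤ q := Nat.div_le_div_left (le_max_right _ _) (by omega)
    have hqmul : q * (3 * (M + 1)) ≤ ℓ := Nat.div_mul_le_self ℓ (3 * (M + 1))
    have hA : 3 * (q * M) ≤ ℓ := by
      have : 3 * (q * M) ≤ q * (3 * (M + 1)) := by nlinarith
      omega
    have hbudget : ((univ.filter fun g : Fin (L + ℓ + R + 1) => s < (wsupp lam g).card).card + 2) * M ≤ ℓ := by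
      have h1 : ((univ.filter fun g : Fin (L + ℓ + R + 1) => s < (wsupp lam g).card).card + 2) * M ≤ (q + 2) * M :=
        Nat.mul_le_mul_right _ (by omega)
      have h2 : (q + 2) * M = q * M + 2 * M := by ring
      omega
    exact le_trans (hMix L ℓ R c y lam rr hyl hgap hbudget) (mul_le_mul_of_nonneg_right (le_max_left θ₁ θ₂) hpos)

/-- With the mixed law a theorem, the crowd piece IS the high-rank piece (every `s`, `p ≠ 3`). -/
theorem highRank_iff_crowd (hp3 : p ≠ 3) (s : ℕ) : WindowHighRankLinSel p ↔ WindowCrowdLinSel p s :=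
  ⟨crowd_of_highRank p s, highRank_of_mixed_crowd p s (windowMixedLinSel_holds p hp3)⟩

/-- **Residual of rung R5 after the mixed law** (`p ≥ 5`, any `s`): crowded windows and the no-window core. -/
theorem r5_residual_crowd (hp : 5 ≤ p) (s : ℕ) (hCr : WindowCrowdLinSel p s) (hN : NoWindowLinSel p) :
    WalkHardFLinSel p :=
  r5_residual hp (highRank_of_mixed_crowd p s (windowMixedLinSel_holds p (by omega)) hCr) hN

/-- **THE MIXED DIAL** (`p ≥ 5`): the mixed law holds and contains the junta law; the crowd piece is the high-rank
piece; crowd ∧ no-window ⟹ R5. -/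
theorem mixed_dial (hp : 5 ≤ p) :
    WindowMixedLinSel p ∧ (WindowMixedLinSel p → WindowJuntaLinSel p) ∧
      (∀ s, (WindowHighRankLinSel p ↔ WindowCrowdLinSel p s)) ∧
      (∀ s, WindowCrowdLinSel p s → NoWindowLinSel p → WalkHardFLinSel p) :=
  ⟨windowMixedLinSel_holds p (by omega), windowJunta_of_mixed p, highRank_iff_crowd p (by omega),
    r5_residual_crowd p hp⟩

end MixedPieces

end Summit.QuantumAdvantage.QuantumAdvantage.Theorems.RankDial

end
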